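import Summits.ValiantsHypothesis.ValiantsHypothesis.Theorems.LacunarySymmetroidMatrixDescartesNsdPivotLoneParallelDesign

/-!
# `MatrixDescartes` (stmt-ValiantsHypothesis-18050) — the `(1 | K−1)` NSD rows FOR EVERY `K` after the oblique parallel cluster:
# rank-one lone letter `∈ {2K − 2, 2K − 1}`, free lone letter `∈ {2K − 1, 2K}` (LINEAR floors replace the constant floors `7` / `8`)

HONEST FRAMING.  Cell `pub-symmetroid`, seat `val-sym-mdr-p2` (gen 29); helper file `--supports` the crux
`Theses.LacunarySymmetroid.MatrixDescartes` (OPEN), NO closure claim.  BOOKKEEPING over the companion `…NsdPivotLoneParallelDesign`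
(the oblique parallel cluster: `exists_rankOne_design`, `2F` certified roots with `F` parallel rank-one upper letters and a rank-one
lone letter; `exists_signed_certificate`, its signed certificate with margins) in the row format of gens 27–28
(`NsdLoneRankOne.nsd_loneBelow_rankOne_three_iff`, `NsdLoneLadder.loneBelow_rankOne_bracket`, `Persistence.…genuine…`):
* §1 RANK-ONE LONE LETTER: every budget valid for the `(1 | K−1)` NSD class with a rank-`≤ 1` lone letter is `≥ 2K − 2`
  (`twoK_sub_two_le_budget_loneBelow_rankOne`; GENUINE sub-class — non-zero letters, pairwise distinct exponents — as well), and
  `2K − 1` is valid (gen 27's END LAW): **the row is `2K − 2` or `2K − 1` for every `K`** (`loneBelow_rankOne_bracket_allK`);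
  exact values of record `5` (`K = 3`), `7` (`K = 4`); **`K = 5`: `8` or `9`** (`loneBelow_rankOne_five`; gens 27–28 had located `7`
  and asked «7 or 9?»).
* §2 FREE LONE LETTER: with the lone letter `!![1,1;1,1+δ]` of full rank (`δ > 0` below every margin of the signed certificate) the
  determinant gains `δ(1 − t)`: the `2F` signs on `(0, 1]` persist and the value at `0⁺` becomes `+δ > 0` — ONE MORE ROOT near `0`
  (`exists_signed_certificate_fullRank`, the signed certificate with `2F + 2` points, exposed for the tilted follow-up;
  `exists_fullRank_design`, `2F + 1 = 2K − 1` roots).  So every budget valid for the free-lone `(1 | K−1)` NSD class is `≥ 2K − 1`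
  (`twoK_sub_one_le_budget_loneBelow`, genuine version too) and `2K` is valid (the tree's NSD `2K` law,
  `DefinitePivot.pivotPosRoots_le_two_mul_of_det_nonneg`): **the row is `2K − 1` or `2K` for every `K`** (`loneBelow_bracket_allK`);
  exact values of record `6` (`K = 3`), `8` (`K = 4`); `K = 5`: `9` or `10` (`loneBelow_five`).
So on both `(1 | K−1)` NSD rows the END LAW («a singular lone letter costs one root») and Descartes are now matched by designed floors
up to ONE root for every `K`; which of the two values holds for `K ≥ 5` stays OPEN (the parallel design is Descartes-sharp for ITS
sign pattern, `2K − 2` / `2K − 1`; the extra root at `K = 3, 4` came from non-parallel upper letters).  Nothing here bears on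
`MatrixDescartes` in its window, on `DoorA26` / `DoorA34`, on the cell's registers beyond these sub-rows, or on `VP ≠ VNP`.

[folklore] Bookkeeping over the companion file and the cited tree ceilings; the objects are this seat's (gen 29).
-/

set_option linter.dupNamespace false

namespace Summit.ValiantsHypothesis.ValiantsHypothesis.Theorems.LacunarySymmetroidMatrixDescartes.Pivot.NsdLoneParallelRows

open Polynomial Matrix Finset Filter Topology NsdLoneParallelDesign
open scoped BigOperators

/-! ## 1. Rank-one lone letter: the row is `2K − 2` or `2K − 1` for every `K` -/

/-- **ALL-K FLOOR `2K − 2` for the rank-one-lone `(1 | K−1)` NSD row.**  Any budget valid for every `2 × 2` pivot pencil with `−J ⪰ 0`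
and `K` PSD letters, exactly one of which — of rank `≤ 1` — lies strictly below the pivot exponent and all others strictly above, is
at least `2K − 2` (supersedes the constant floor `7` of `NsdLoneLadder.seven_le_budget_loneBelow_rankOne` for `K ≥ 5`; natural
subtraction, vacuous at `K = 0`). [folklore] -/
theorem twoK_sub_two_le_budget_loneBelow_rankOne {K B : ℕ}
    (h : ∀ (e : ℕ) (d : Fin K → ℕ) (J : Matrix (Fin 2) (Fin 2) ℝ) (P : Fin K → Matrix (Fin 2) (Fin 2) ℝ) (k₀ : Fin K),
        (-J).PosSemidef → (∀ k, (P k).PosSemidef) → d k₀ < e → (∀ k, k ≠ k₀ → e < d k) → (P k₀).det = 0 →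
        pivotPosRoots e d J P ≤ B) : 2 * K - 2 ≤ B := by
  cases K with
  | zero => simp
  | succ F =>
    obtain ⟨D, A, hD, hD2, hA, hZ⟩ := exists_rankOne_design F
    have hB := h 1 (Fin.cons 0 D : Fin (F + 1) → ℕ) _
      (Fin.cons (!![(1 : ℝ), 1; 1, 1]) (fun k => !![(0 : ℝ), 0; 0, A k]) : Fin (F + 1) → Matrix (Fin 2) (Fin 2) ℝ) 0
      neg_J_posSemidef (letters_posSemidef hA le_rfl) (by simp)
      (fun k hk => by
        cases k using Fin.cases with
        | zero => exact absurd rfl hk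
        | succ k' => have := hD2 k'; simp only [Fin.cons_succ]; omega)
      (by simp [Matrix.det_fin_two])
    omega

/-- **GENUINE ALL-K FLOOR `2K − 2`** (the class restricted to NON-ZERO letters at PAIRWISE DISTINCT exponents — the design is genuine as
it stands; supersedes `Persistence.seven_le_budget_genuine_loneBelow_rankOne` for `K ≥ 5`). [folklore] -/
theorem twoK_sub_two_le_budget_genuine_loneBelow_rankOne {K B : ℕ}
    (h : ∀ (e : ℕ) (d : Fin K → ℕ) (J : Matrix (Fin 2) (Fin 2) ℝ) (P : Fin K → Matrix (Fin 2) (Fin 2) ℝ) (k₀ : Fin K),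
        (-J).PosSemidef → Function.Injective d → (∀ k, (P k).PosSemidef ∧ P k ≠ 0) → d k₀ < e → (∀ k, k ≠ k₀ → e < d k) →
        (P k₀).det = 0 → pivotPosRoots e d J P ≤ B) : 2 * K - 2 ≤ B := by
  cases K with
  | zero => simp
  | succ F =>
    obtain ⟨D, A, hD, hD2, hA, hZ⟩ := exists_rankOne_design F
    have hB := h 1 (Fin.cons 0 D : Fin (F + 1) → ℕ) _
      (Fin.cons (!![(1 : ℝ), 1; 1, 1]) (fun k => !![(0 : ℝ), 0; 0, A k]) : Fin (F + 1) → Matrix (Fin 2) (Fin 2) ℝ) 0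
      neg_J_posSemidef (exponents_injective hD hD2)
      (fun k => ⟨letters_posSemidef hA le_rfl k, letters_ne_zero hA 1 k⟩) (by simp)
      (fun k hk => by
        cases k using Fin.cases with
        | zero => exact absurd rfl hk
        | succ k' => have := hD2 k'; simp only [Fin.cons_succ]; omega)
      (by simp [Matrix.det_fin_two])
    omega

/-- **THE RANK-ONE-LONE `(1 | K−1)` NSD ROW IS `2K − 2` OR `2K − 1` FOR EVERY `K`**: every valid budget is `≥ 2K − 2` (the oblique
parallel cluster), and `2K − 1` is valid (gen 27's END LAW `NsdLoneRankOne.pivotPosRoots_succ_le_of_lone_below`).  Known exact values: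
`K = 3`: `5`, `K = 4`: `7` (both `= 2K − 1`); `K ≥ 5`: `2K − 2` or `2K − 1`, OPEN which. [folklore] -/
theorem loneBelow_rankOne_bracket_allK (K : ℕ) :
    (∀ B : ℕ, (∀ (e : ℕ) (d : Fin K → ℕ) (J : Matrix (Fin 2) (Fin 2) ℝ) (P : Fin K → Matrix (Fin 2) (Fin 2) ℝ) (k₀ : Fin K),
        (-J).PosSemidef → (∀ k, (P k).PosSemidef) → d k₀ < e → (∀ k, k ≠ k₀ → e < d k) → (P k₀).det = 0 →
        pivotPosRoots e d J P ≤ B) → 2 * K - 2 ≤ B) ∧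
    (∀ (e : ℕ) (d : Fin K → ℕ) (J : Matrix (Fin 2) (Fin 2) ℝ) (P : Fin K → Matrix (Fin 2) (Fin 2) ℝ) (k₀ : Fin K),
        (-J).PosSemidef → (∀ k, (P k).PosSemidef) → d k₀ < e → (∀ k, k ≠ k₀ → e < d k) → (P k₀).det = 0 →
        pivotPosRoots e d J P ≤ 2 * K - 1) := by
  refine ⟨fun B hB => twoK_sub_two_le_budget_loneBelow_rankOne hB, fun e d J P k₀ hJ hP hbot hup hrk => ?_⟩
  have h := NsdLoneRankOne.pivotPosRoots_succ_le_of_lone_below e d J P hJ hP k₀ hbot hup hrk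
  omega

/-- **`K = 5`: the rank-one-lone `(1 | 4)` NSD row is `8` or `9`** (gens 27–28 located only `7` and asked «7 or 9?»; the parallel design
gives `8`, the END LAW caps at `9`). [folklore] -/
theorem loneBelow_rankOne_five (B : ℕ)
    (h : ∀ (e : ℕ) (d : Fin 5 → ℕ) (J : Matrix (Fin 2) (Fin 2) ℝ) (P : Fin 5 → Matrix (Fin 2) (Fin 2) ℝ) (k₀ : Fin 5),
        (-J).PosSemidef → (∀ k, (P k).PosSemidef) → d k₀ < e → (∀ k, k ≠ k₀ → e < d k) → (P k₀).det = 0 →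
        pivotPosRoots e d J P ≤ B) : 8 ≤ B := by
  have := twoK_sub_two_le_budget_loneBelow_rankOne h
  omega


/-! ## 2. Free (full-rank) lone letter: one more root near `t = 0`, so `2K − 1` for every `K` -/

/-- **Signed certificate, FULL-RANK lone letter.**  Replacing the lone letter by `!![1, 1; 1, 1 + δ]` (`δ > 0` below every margin
of the rank-one certificate) adds `δ (1 − t)` to the determinant: the `2F + 1` certified signs on `(0, 1]` persist and the value at
`0⁺` turns POSITIVE (`= δ` at `t = 0`): `2F + 2` points `0 < t₀ < τ 0 < ⋯ ≤ 1` with signs `+, −, +, …` for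
`g(t) = (1 − t)·∑ₖ t^{D k} A k − t(2 − t) + δ(1 − t)`. [folklore] -/
theorem exists_signed_certificate_fullRank (F : ℕ) :
    ∃ (D : Fin F → ℕ) (A : Fin F → ℝ) (δ : ℝ) (τ : Fin (2 * F + 1 + 1) → ℝ),
      StrictAnti D ∧ (∀ k, 2 ≤ D k) ∧ (∀ k, 0 < A k) ∧ 0 < δ ∧ StrictMono τ ∧ (∀ i, 0 < τ i) ∧ (∀ i, τ i ≤ 1) ∧
      ∀ i : Fin (2 * F + 1 + 1),
        0 < (-1 : ℝ) ^ (i : ℕ) * ((1 - τ i) * (∑ k, τ i ^ D k * A k) - τ i * (2 - τ i) + δ * (1 - τ i)) := by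
  obtain ⟨D, A, τ, hD, hD2, hA, hτ, hτ0, hτ1, hsign⟩ := exists_signed_certificate F
  set f : ℝ → ℝ := fun t => (1 - t) * (∑ k, t ^ D k * A k) - t * (2 - t) with hf
  have hfne : ∀ i, f (τ i) ≠ 0 := fun i h0 => by
    have h := hsign i
    rw [show (1 - τ i) * (∑ k, τ i ^ D k * A k) - τ i * (2 - τ i) = f (τ i) from rfl, h0, mul_zero] at h
    exact lt_irrefl _ h
  -- a positive `δ` below every margin
  obtain ⟨δ, hδ0, hδ⟩ : ∃ δ : ℝ, 0 < δ ∧ ∀ i, δ < |f (τ i)| := by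
    have h1 : ∀ᶠ δ in 𝓝[>] (0 : ℝ), ∀ i, δ < |f (τ i)| :=
      nhdsWithin_le_nhds (eventually_all.2 fun i => eventually_lt_nhds (abs_pos.mpr (hfne i)))
    have h2 : ∀ᶠ δ in 𝓝[>] (0 : ℝ), δ ∈ Set.Ioi (0 : ℝ) := self_mem_nhdsWithin
    obtain ⟨δ, h, hI⟩ := (h1.and h2).exists
    exact ⟨δ, hI, h⟩
  -- the perturbed determinant
  set g : ℝ → ℝ := fun t => f t + δ * (1 - t) with hg
  have hgc : Continuous g := by rw [hg, hf]; fun_prop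
  have hg0 : g 0 = δ := by
    simp only [hg, hf]
    have : ∀ k, (0 : ℝ) ^ D k * A k = 0 := fun k => by
      rw [zero_pow (by have := hD2 k; omega), zero_mul]
    simp [this]
  -- a point `t₀ ∈ (0, τ 0)` with `g t₀ > 0`
  obtain ⟨t₀, hgt₀, ht₀0, ht₀τ⟩ : ∃ t₀, 0 < g t₀ ∧ 0 < t₀ ∧ t₀ < τ 0 := by
    have h1 : ∀ᶠ t in 𝓝[>] (0 : ℝ), 0 < g t :=
      nhdsWithin_le_nhds ((hgc.tendsto 0).eventually_const_lt (by rw [hg0]; exact hδ0))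
    have h2 : ∀ᶠ t in 𝓝[>] (0 : ℝ), t ∈ Set.Ioo 0 (τ 0) := Ioo_mem_nhdsGT (hτ0 0)
    obtain ⟨t₀, h, hI⟩ := (h1.and h2).exists
    exact ⟨t₀, h, hI.1, hI.2⟩
  refine ⟨D, A, δ, Fin.cons t₀ τ, hD, hD2, hA, hδ0,
    strictMono_cons hτ fun j => ht₀τ.trans_le (hτ.monotone (Fin.zero_le j)), fun i => ?_, fun i => ?_, fun m => ?_⟩
  · cases i using Fin.cases with
    | zero => simpa using ht₀0
    | succ i' => simpa using hτ0 i'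
  · cases i using Fin.cases with
    | zero => simpa using (ht₀τ.trans_le (hτ1 0)).le
    | succ i' => simpa using hτ1 i'
  · -- the signed certificate of `g` on `t₀, τ 0, …, τ (2F)`: signs `+, −, +, …`
    cases m using Fin.cases with
    | zero => simpa [hg, hf] using hgt₀
    | succ i =>
      simp only [Fin.cons_succ, Fin.val_succ, pow_succ]
      -- persistence at `τ i`: `|δ (1 − τ i)| < |f (τ i)|`
      have hpert : |-(δ * (1 - τ i))| < |-f (τ i)| := by
        rw [abs_neg, abs_neg, abs_of_nonneg (mul_nonneg hδ0.le (by linarith [hτ1 i]))]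
        have : δ * (1 - τ i) ≤ δ := by nlinarith [hτ0 i, hτ1 i]
        linarith [hδ i]
      have h0 : 0 < (-1 : ℝ) ^ (i : ℕ) * (-f (τ i)) := by have := hsign i; linarith
      have h := sign_persists h0 hpert
      have hfi : f (τ i) = (1 - τ i) * (∑ k, τ i ^ D k * A k) - τ i * (2 - τ i) := rfl
      rw [hfi] at h
      linarith

/-- **THE OBLIQUE PARALLEL CLUSTER WITH A FULL-RANK LONE LETTER: `2F + 1` positive roots** (`F` parallel rank-one upper letters,
lone letter `!![1, 1; 1, 1 + δ]` of full rank). [folklore] -/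
theorem exists_fullRank_design (F : ℕ) :
    ∃ (D : Fin F → ℕ) (A : Fin F → ℝ) (δ : ℝ), StrictAnti D ∧ (∀ k, 2 ≤ D k) ∧ (∀ k, 0 < A k) ∧ 0 < δ ∧
      2 * F + 1 ≤ pivotPosRoots 1 (Fin.cons 0 D : Fin (F + 1) → ℕ) (!![(-1 : ℝ), 0; 0, -1] : Matrix (Fin 2) (Fin 2) ℝ)
        (Fin.cons (!![(1 : ℝ), 1; 1, 1 + δ]) (fun k => !![(0 : ℝ), 0; 0, A k]) : Fin (F + 1) → Matrix (Fin 2) (Fin 2) ℝ) := by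
  obtain ⟨D, A, δ, τ, hD, hD2, hA, hδ0, hτ, hτ0, _, hsign⟩ := exists_signed_certificate_fullRank F
  have halt := alternate_of_signed (τ := τ)
    (g := fun t => -((1 - t) * (∑ k, t ^ D k * A k) - t * (2 - t) + δ * (1 - t))) (fun i => by
      have := hsign i; linarith)
  refine ⟨D, A, δ, hD, hD2, hA, hδ0, ?_⟩
  exact le_pivotPosRoots_of_certificate (N := 2 * F + 1)
    (f := fun t => (1 - t) * (∑ k, t ^ D k * A k) - t * (2 - t) + δ * (1 - t)) (fun t => by rw [eval_det_design])
    τ hτ hτ0 (fun j => by have := halt j; nlinarith [this])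

/-- **ALL-K FLOOR `2K − 1` for the free-lone `(1 | K−1)` NSD row** (lone letter of any rank; supersedes the constant floor `8` of
`NsdLoneLadder.eight_le_budget_loneBelow` for `K ≥ 5`; natural subtraction, vacuous at `K = 0`). [folklore] -/
theorem twoK_sub_one_le_budget_loneBelow {K B : ℕ}
    (h : ∀ (e : ℕ) (d : Fin K → ℕ) (J : Matrix (Fin 2) (Fin 2) ℝ) (P : Fin K → Matrix (Fin 2) (Fin 2) ℝ) (k₀ : Fin K),
        (-J).PosSemidef → (∀ k, (P k).PosSemidef) → d k₀ < e → (∀ k, k ≠ k₀ → e < d k) →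
        pivotPosRoots e d J P ≤ B) : 2 * K - 1 ≤ B := by
  cases K with
  | zero => simp
  | succ F =>
    obtain ⟨D, A, δ, hD, hD2, hA, hδ, hZ⟩ := exists_fullRank_design F
    have hB := h 1 (Fin.cons 0 D : Fin (F + 1) → ℕ) _
      (Fin.cons (!![(1 : ℝ), 1; 1, 1 + δ]) (fun k => !![(0 : ℝ), 0; 0, A k]) : Fin (F + 1) → Matrix (Fin 2) (Fin 2) ℝ) 0
      neg_J_posSemidef (letters_posSemidef hA (by linarith)) (by simp)
      (fun k hk => by
        cases k using Fin.cases with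
        | zero => exact absurd rfl hk
        | succ k' => have := hD2 k'; simp only [Fin.cons_succ]; omega)
    omega

/-- **GENUINE ALL-K FLOOR `2K − 1`, free lone letter** (non-zero letters, pairwise distinct exponents; supersedes
`Persistence.eight_le_budget_genuine_loneBelow` for `K ≥ 5`). [folklore] -/
theorem twoK_sub_one_le_budget_genuine_loneBelow {K B : ℕ}
    (h : ∀ (e : ℕ) (d : Fin K → ℕ) (J : Matrix (Fin 2) (Fin 2) ℝ) (P : Fin K → Matrix (Fin 2) (Fin 2) ℝ) (k₀ : Fin K),
        (-J).PosSemidef → Function.Injective d → (∀ k, (P k).PosSemidef ∧ P k ≠ 0) → d k₀ < e → (∀ k, k ≠ k₀ → e < d k) →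
        pivotPosRoots e d J P ≤ B) : 2 * K - 1 ≤ B := by
  cases K with
  | zero => simp
  | succ F =>
    obtain ⟨D, A, δ, hD, hD2, hA, hδ, hZ⟩ := exists_fullRank_design F
    have hB := h 1 (Fin.cons 0 D : Fin (F + 1) → ℕ) _
      (Fin.cons (!![(1 : ℝ), 1; 1, 1 + δ]) (fun k => !![(0 : ℝ), 0; 0, A k]) : Fin (F + 1) → Matrix (Fin 2) (Fin 2) ℝ) 0
      neg_J_posSemidef (exponents_injective hD hD2)
      (fun k => ⟨letters_posSemidef hA (by linarith) k, letters_ne_zero hA _ k⟩) (by simp)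
      (fun k hk => by
        cases k using Fin.cases with
        | zero => exact absurd rfl hk
        | succ k' => have := hD2 k'; simp only [Fin.cons_succ]; omega)
    omega

/-- **THE FREE-LONE `(1 | K−1)` NSD ROW IS `2K − 1` OR `2K` FOR EVERY `K`**: every valid budget is `≥ 2K − 1` (full-rank oblique
parallel cluster) and `2K` is valid (the tree's NSD `2K` law `DefinitePivot.pivotPosRoots_le_two_mul_of_det_nonneg`).  Known exact
values: `K = 3`: `6`, `K = 4`: `8` (both `= 2K`); `K ≥ 5`: OPEN which. [folklore] -/
theorem loneBelow_bracket_allK (K : ℕ) :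
    (∀ B : ℕ, (∀ (e : ℕ) (d : Fin K → ℕ) (J : Matrix (Fin 2) (Fin 2) ℝ) (P : Fin K → Matrix (Fin 2) (Fin 2) ℝ) (k₀ : Fin K),
        (-J).PosSemidef → (∀ k, (P k).PosSemidef) → d k₀ < e → (∀ k, k ≠ k₀ → e < d k) →
        pivotPosRoots e d J P ≤ B) → 2 * K - 1 ≤ B) ∧
    (∀ (e : ℕ) (d : Fin K → ℕ) (J : Matrix (Fin 2) (Fin 2) ℝ) (P : Fin K → Matrix (Fin 2) (Fin 2) ℝ),
        (-J).PosSemidef → (∀ k, (P k).PosSemidef) → pivotPosRoots e d J P ≤ 2 * K) := by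
  refine ⟨fun B hB => twoK_sub_one_le_budget_loneBelow hB, fun e d J P hJ hP => ?_⟩
  have hdet : 0 ≤ J.det := by
    have h := hJ.det_nonneg
    rwa [Matrix.det_neg, Fintype.card_fin, show ((-1 : ℝ) ^ 2) = 1 by norm_num, one_mul] at h
  exact DefinitePivot.pivotPosRoots_le_two_mul_of_det_nonneg e d J P hP hdet

/-- **`K = 5`: the free-lone `(1 | 4)` NSD row is `9` or `10`** (located `8` before). [folklore] -/
theorem loneBelow_five (B : ℕ)
    (h : ∀ (e : ℕ) (d : Fin 5 → ℕ) (J : Matrix (Fin 2) (Fin 2) ℝ) (P : Fin 5 → Matrix (Fin 2) (Fin 2) ℝ) (k₀ : Fin 5),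
        (-J).PosSemidef → (∀ k, (P k).PosSemidef) → d k₀ < e → (∀ k, k ≠ k₀ → e < d k) →
        pivotPosRoots e d J P ≤ B) : 9 ≤ B := by
  have := twoK_sub_one_le_budget_loneBelow h
  omega

end Summit.ValiantsHypothesis.ValiantsHypothesis.Theorems.LacunarySymmetroidMatrixDescartes.Pivot.NsdLoneParallelRows
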